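import Literature.Computability.Complexity.Williams2014SatInstance
import HarnessLib

/-!
# Williams' Theorem 3.2: the code of the SAT instance `D` as a function of the printed codes

Companion of `Williams2014SatInstance.lean` (the explicit instance
`WitnessCheck.satInstance G W m`) and `Williams2014MachineB.lean` (the machine `B` assembled
from its stages; R. Williams, *Nonuniform ACC circuit lower bounds*, J. ACM 61 (2014), proof
of Thm. 3.2, p. 13: "`B` … constructs an `ACC` CIRCUIT SAT instance `D`"). The stage `F` of
`B` must compute the string code `encodeAccCircuit m D` from the printout of the clause circuits
`G κ` (`encodeAccCircuitList m`, `Williams2014Lemma31.lean`) and the guessed code of `W`. This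
file is the MATHEMATICAL half of that stage: the same construction carried out on codes —
lists of naturals — with the proof that it yields the code of `D`:

* the code-level vocabulary `SatCode.WireC = ℕ × ℕ`, `SatCode.GateC = ℕ × List WireC`,
  `wireC`, `gateC m` (symbolic code `accCode m` and argument wires), `flatGate`, `serialize`
  (`= circuitCodeList m`, `circuitCodeList_eq_serialize`);
* the printed codes of the basis gates by arity (`accCode_and`, `accCode_or`/`orCode`,
  `accCode_modGate`/`modCode`: `∨₁ = ∧₁` prints `1`, a `MODₘ` gate of arity `< m` is a
  disjunction and prints `2`, …);
* code-level relocation, plugging, layers and the gate appenders (`shiftC`, `substW`, `relocC`,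
  `plugC`, `parBlocksC`, `andC`/`orC`/`notC`/`or₃C`/`addSlotC`), each commuting with `gateC m`
  (`gateC_reloc`, `map_gateC_plug`, `map_gateC_parBlocks`, `map_gateC_addSlot`, …);
* fan-in normalisation on codes `normC m` with re-coding, `gateC_normFanIn`;
* the stages on codes `sGC`, `TC` (output table), `rhoC` (input tables of the copies of `W`),
  `s1C … s8C`, and **`satInstanceC_eq`** / **`circuitC_eq`**: on the codes of the `G κ` in print
  order (`famC`) and of `W`, `satInstanceC` is `circuitCodeList m (satInstance G W m)` and
  `circuitC` (no normalisation) is `circuitCodeList m (circuit G W)` — for ALL `G`, `W`;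
* the DECODING side for the guessed witness: `validC n dW sz` (admissible gates `gateOK` —
  code `≤ 3`, negations unary, wires in range/acyclic —, output in range, size and `ac`-depth
  bounds via the computed depths `depthsC`), `realize` (the circuit of a valid code) with
  `realize_isOver`, `size_realize`, `acDepth_realize_le`, `map_gateC_realize` (its gates print
  as the CANONICALISED codes `canonC m`), `wireC_realize_output`; conversely printed codes of
  circuits over `accBasis m` are valid and canonical (`validC_of_circuit`,
  `map_canonC_map_gateC`);
* the flat-code PARSER as a fold with a four-register state (`PS`, `pstep`, `parseFlat`,
  `rawToGate`, `deserialize`; `parseFlat_flatMap`, `deserialize_serialize`,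
  `arity_le_of_deserialize`) — the shape in which the string stage implements it;
* the glue for the two clauses of `SatInstanceFn.Spec` (`Williams2014MachineB.lean`):
  `circuitC_realize` (soundness) and `circuitC_of_circuit` (completeness).

Everything is elementary list manipulation; no machine appears here.

## References

* R. Williams, *Nonuniform ACC circuit lower bounds*, J. ACM 61(1) (2014) 2:1–2:32, proof of
  Thm. 3.2 (p. 13) [Williams2014].
* S. Arora, B. Barak, *Computational Complexity: A Modern Approach*, CUP 2009, §0.1 and Rem. 6.4
  (straight-line programs as strings) [AroraBarak2009].
* H. Vollmer, *Introduction to Circuit Complexity*, Springer 1999, §1.2 (composition).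
-/

namespace Literature.Computability.Complexity

open GateList

namespace SatCode

/-! ### Codes of wires and gates -/

/-- The code of a wire: `(0, i)` for the input `i`, `(1, j)` for gate `j` (`wireCode`).
[folklore] -/
abbrev WireC : Type := ℕ × ℕ

/-- The code of a gate: symbolic code and argument wires (`gateCodeList` without the arity
field, which is the number of wires). [folklore] -/
abbrev GateC : Type := ℕ × List WireC

/-- The code of a wire. [folklore] -/
def wireC {n : ℕ} : Fin n ⊕ ℕ → WireC
  | Sum.inl i => (0, (i : ℕ))
  | Sum.inr j => (1, j)

/-- `wireCode` is the flattened `wireC`. [folklore] -/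
theorem wireCode_eq {n : ℕ} (u : Fin n ⊕ ℕ) : wireCode u = [(wireC u).1, (wireC u).2] := by
  cases u <;> rfl

/-- `wireC` is injective. [folklore] -/
theorem wireC_injective {n : ℕ} : Function.Injective (wireC (n := n)) := by
  rintro (i | j) (i' | j') h <;> simp only [wireC, Prod.mk.injEq] at h
  · exact congrArg Sum.inl (Fin.ext h.2)
  · exact absurd h.1 zero_ne_one
  · exact absurd h.1 one_ne_zero
  · rw [h.2]

/-- The code of a gate over `accBasis m`. [folklore] -/
def gateC (m : ℕ) {n : ℕ} (g : Gate (Fin n)) : GateC :=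
  (accCode m g.fn, (List.ofFn g.args).map wireC)

/-- Flattening a gate code: code, arity, wires. [folklore] -/
def flatGate (g : GateC) : List ℕ := g.1 :: g.2.length :: g.2.flatMap fun p => [p.1, p.2]

/-- `gateCodeList` is the flattened `gateC`. [folklore] -/
theorem gateCodeList_eq (m : ℕ) {n : ℕ} (g : Gate (Fin n)) : gateCodeList m g = flatGate (gateC m g) := by
  simp only [gateCodeList, flatGate, gateC, List.length_map, List.length_ofFn, List.flatMap_map]
  congr 2
  exact List.flatMap_congr fun u _ => wireCode_eq u

/-- Serialising a circuit code: inputs, output wire, size, then the flattened gates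
(`circuitCodeList`). [folklore] -/
def serialize (n : ℕ) (out : WireC) (gs : List GateC) : List ℕ :=
  n :: out.1 :: out.2 :: gs.length :: gs.flatMap flatGate

/-- **`circuitCodeList` is `serialize` of the codes.** [folklore] -/
theorem circuitCodeList_eq_serialize (m : ℕ) {n : ℕ} (C : Circuit (Fin n)) :
    circuitCodeList m C = serialize n (wireC C.output) (C.gates.map (gateC m)) := by
  simp only [circuitCodeList, serialize, wireCode_eq, List.cons_append, List.nil_append,
    List.length_map, List.flatMap_map, Circuit.size]
  rw [List.flatMap_congr fun g _ => gateCodeList_eq m g]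

/-! ### Symbolic codes of the basis gates, by arity -/

/-- `∨ₖ ≠ ∧ₖ` unless `k = 1`. [folklore] -/
theorem or_ne_and {k : ℕ} (hk : k ≠ 1) : GateFn.or k ≠ GateFn.and k := by
  intro h
  have h2 := congrFun (eq_of_heq (Sigma.mk.inj h).2) (fun i => decide ((i : ℕ) = 0))
  rcases Nat.lt_or_ge k 1 with hk0 | hk1
  · have : k = 0 := by omega
    subst this
    simp at h2
  · have hk2 : 2 ≤ k := by omega
    simp only [decide_eq_decide] at h2
    have h3 : (∀ i : Fin k, decide ((i : ℕ) = 0) = true) := h2.1 ⟨⟨0, by omega⟩, by simp⟩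
    have := h3 ⟨1, by omega⟩
    simp at this

/-- `∨₁ = ∧₁` (both are the identity). [folklore] -/
theorem or_one_eq_and_one : GateFn.or 1 = GateFn.and 1 := by
  simp only [GateFn.or, GateFn.and, Sigma.mk.injEq, heq_eq_eq, true_and]
  funext v
  simp [Fin.forall_fin_one, Fin.exists_fin_one]

/-- `MODₘ,ₖ ≠ ¬`. [folklore] -/
theorem modGate_ne_not (m k : ℕ) : GateFn.modGate m k ≠ GateFn.not := by
  intro h
  have hk : k = 1 := congrArg Sigma.fst h
  subst hk
  have h2 := congrFun (eq_of_heq (Sigma.mk.inj h).2) (fun _ => false)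
  simp [GateFn.numOnes] at h2

/-- The number of ones of the indicator of `i < t` on `Fin k` is `t` (`t ≤ k`). [folklore] -/
theorem numOnes_lt_indicator {k t : ℕ} (ht : t ≤ k) :
    GateFn.numOnes (fun i : Fin k => decide ((i : ℕ) < t)) = t := by
  unfold GateFn.numOnes
  have : (Finset.univ.filter fun i : Fin k => decide ((i : ℕ) < t) = true) =
      (Finset.univ : Finset (Fin t)).map (Fin.castLEEmb ht) := by
    ext i
    simp only [Finset.mem_filter, Finset.mem_univ, true_and, decide_eq_true_eq, Finset.mem_map,
      Fin.castLEEmb_apply]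
    constructor
    · intro hi
      exact ⟨⟨i, hi⟩, Fin.ext rfl⟩
    · rintro ⟨j, rfl⟩
      exact j.2
  rw [this, Finset.card_map, Finset.card_univ, Fintype.card_fin]

/-- `MODₘ,ₖ = ∧ₖ` iff `k = 1` and `m ≠ 1`. [folklore] -/
theorem modGate_eq_and_iff (m k : ℕ) : GateFn.modGate m k = GateFn.and k ↔ k = 1 ∧ m ≠ 1 := by
  constructor
  · intro h
    have h2 := fun v => congrFun (eq_of_heq (Sigma.mk.inj h).2) v
    simp only [decide_eq_decide] at h2
    -- `k ≠ 0`: at the empty assignment `∧₀` is true, `MOD` false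
    have hk0 : k ≠ 0 := by
      rintro rfl
      have := h2 (fun i => i.elim0)
      simp [GateFn.numOnes] at this
    -- all ones: `k % m ≠ 0`
    have hall := (h2 fun _ => true).2 (fun _ => rfl)
    -- exactly one one: `1 % m ≠ 0 ↔ k = 1`-ish
    have hone := h2 fun i => decide ((i : ℕ) < 1)
    rw [numOnes_lt_indicator (by omega)] at hone
    by_cases hk1 : k = 1
    · subst hk1
      refine ⟨rfl, ?_⟩
      rintro rfl
      simp [GateFn.numOnes] at hall
    · exfalso
      have hk2 : 2 ≤ k := by omega
      have hnot : ¬ ∀ i : Fin k, decide ((i : ℕ) < 1) = true := fun hc => by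
        have := hc ⟨1, by omega⟩; simp at this
      have h1m : 1 % m = 0 := by
        by_contra hc
        exact hnot (hone.1 hc)
      have hm1 : m = 1 := by
        rcases Nat.lt_or_ge m 2 with hm | hm
        · interval_cases m <;> simp_all
        · rw [Nat.mod_eq_of_lt (by omega)] at h1m; exact absurd h1m one_ne_zero
      subst hm1
      exact hall (Nat.mod_one _)
  · rintro ⟨rfl, hm⟩
    simp only [GateFn.modGate, GateFn.and, Sigma.mk.injEq, heq_eq_eq, true_and]
    funext v
    have h1 : 1 % m ≠ 0 := by
      rcases Nat.lt_or_ge m 2 with hm' | hm'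
      · interval_cases m <;> simp_all
      · rw [Nat.mod_eq_of_lt (by omega)]; exact one_ne_zero
    cases hv : v 0
    · have : GateFn.numOnes v = 0 := by
        simp [GateFn.numOnes, Finset.filter_eq_empty_iff, hv]
      simp [this, Fin.forall_fin_one, hv]
    · have hf : (Finset.univ.filter fun i : Fin 1 => v i = true) = Finset.univ := by
        ext i; fin_cases i; simp [hv]
      have : GateFn.numOnes v = 1 := by
        unfold GateFn.numOnes; rw [hf]; simp
      simp [this, Fin.forall_fin_one, hv, h1]

/-- `MODₘ,ₖ = ∨ₖ` iff `m = 0` or `k < m` (no positive multiple of `m` is `≤ k`). [folklore] -/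
theorem modGate_eq_or_iff (m k : ℕ) : GateFn.modGate m k = GateFn.or k ↔ m = 0 ∨ k < m := by
  constructor
  · intro h
    have h2 := fun v => congrFun (eq_of_heq (Sigma.mk.inj h).2) v
    simp only [decide_eq_decide] at h2
    by_contra hc
    have hm0 : m ≠ 0 := fun h0 => hc (Or.inl h0)
    have hmk : m ≤ k := Nat.le_of_not_lt fun h0 => hc (Or.inr h0)
    have := h2 fun i => decide ((i : ℕ) < m)
    rw [numOnes_lt_indicator hmk, Nat.mod_self] at this
    have hex : ∃ i : Fin k, decide ((i : ℕ) < m) = true := ⟨⟨0, by omega⟩, by simp; omega⟩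
    exact absurd (this.2 hex) (by simp)
  · intro h
    simp only [GateFn.modGate, GateFn.or, Sigma.mk.injEq, heq_eq_eq, true_and]
    funext v
    have hle : GateFn.numOnes v ≤ k := by
      unfold GateFn.numOnes
      exact (Finset.card_filter_le _ _).trans (by simp)
    have hmod : GateFn.numOnes v % m = GateFn.numOnes v := by
      rcases h with rfl | h
      · exact Nat.mod_zero _
      · exact Nat.mod_eq_of_lt (by omega)
    rw [hmod]
    simp only [ne_eq, decide_eq_decide]
    unfold GateFn.numOnes
    rw [Finset.card_eq_zero, Finset.filter_eq_empty_iff]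
    simp

/-- Arity of `∧ₖ`. [folklore] -/
@[simp] theorem fst_and (k : ℕ) : (GateFn.and k).1 = k := rfl
/-- Arity of `∨ₖ`. [folklore] -/
@[simp] theorem fst_or (k : ℕ) : (GateFn.or k).1 = k := rfl
/-- Arity of `MODₘ,ₖ`. [folklore] -/
@[simp] theorem fst_modGate (m k : ℕ) : (GateFn.modGate m k).1 = k := rfl

/-- The printed code of `∧ₖ` is `1`. [folklore] -/
theorem accCode_and (m k : ℕ) : accCode m (GateFn.and k) = 1 := by
  unfold accCode
  split_ifs with h0 h1
  · exact absurd h0 (GateFn.and_ne_not k)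
  · rfl
  all_goals exact absurd rfl h1

/-- The printed code of a disjunction by arity: `∨₁ = ∧₁` prints `1`. [folklore] -/
def orCode (k : ℕ) : ℕ := if k = 1 then 1 else 2

/-- The printed code of `∨ₖ` is `orCode k`. [folklore] -/
theorem accCode_or (m k : ℕ) : accCode m (GateFn.or k) = orCode k := by
  unfold accCode
  split_ifs with h0 h1 h2
  · exact absurd h0 (GateFn.or_ne_not k)
  · have hk : k = 1 := by
      by_contra hk
      exact or_ne_and hk h1
    simp [orCode, hk]
  · have hk : k ≠ 1 := fun hk => h1 (by subst hk; exact or_one_eq_and_one)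
    simp [orCode, hk]
  all_goals exact absurd rfl h2

/-- The printed code of `MODₘ` by arity: it prints `1` if it is `∧₁`, `2` if it is a
disjunction, `3` otherwise. [folklore] -/
def modCode (m k : ℕ) : ℕ := if k = 1 ∧ m ≠ 1 then 1 else if m = 0 ∨ k < m then 2 else 3

/-- The printed code of `MODₘ,ₖ` is `modCode m k`. [folklore] -/
theorem accCode_modGate (m k : ℕ) : accCode m (GateFn.modGate m k) = modCode m k := by
  unfold accCode
  split_ifs with h0 h1 h2 h3
  · exact absurd h0 (modGate_ne_not m k)
  · obtain ⟨hk, hm⟩ := (modGate_eq_and_iff m k).1 h1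
    simp [modCode, hk, hm]
  · have hn1 : ¬ (k = 1 ∧ m ≠ 1) := mt (modGate_eq_and_iff m k).2 h1
    have hy2 : m = 0 ∨ k < m := (modGate_eq_or_iff m k).1 h2
    unfold modCode
    rw [if_neg hn1, if_pos hy2]
  · have hn1 : ¬ (k = 1 ∧ m ≠ 1) := mt (modGate_eq_and_iff m k).2 h1
    have hn2 : ¬ (m = 0 ∨ k < m) := mt (modGate_eq_or_iff m k).2 h2
    unfold modCode
    rw [if_neg hn1, if_neg hn2]
  · exact absurd rfl h3

/-! ### Relocation, plugging and layers on codes -/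

/-- A gate reference shifted by `L` (inputs unchanged): `par L` on codes. [folklore] -/
def shiftC (L : ℕ) (p : WireC) : WireC := if p.1 = 0 then p else (p.1, p.2 + L)

/-- `shiftWire ρ L` on codes, the input wiring given as a table `T` of wire codes. [folklore] -/
def substW (T : List WireC) (L : ℕ) (p : WireC) : WireC :=
  if p.1 = 0 then T.getD p.2 (0, 0) else (p.1, p.2 + L)

/-- `reloc ρ L` on codes. [folklore] -/
def relocC (T : List WireC) (L : ℕ) (g : GateC) : GateC := (g.1, g.2.map (substW T L))

/-- `par L` on codes. [folklore] -/
def shiftGateC (L : ℕ) (g : GateC) : GateC := (g.1, g.2.map (shiftC L))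

/-- `wireC` commutes with `shiftWire` (table `T = ofFn (wireC ∘ ρ)`). [folklore] -/
theorem wireC_shiftWire {n n' : ℕ} (ρ : Fin n' → Fin n ⊕ ℕ) (L : ℕ) (u : Fin n' ⊕ ℕ) :
    wireC (shiftWire ρ L u) = substW (List.ofFn fun i => wireC (ρ i)) L (wireC u) := by
  rcases u with i | j
  · simp [shiftWire, substW, wireC, List.getD_eq_getElem?_getD]
  · simp [shiftWire, substW, wireC]

/-- `wireC` commutes with `shiftWire Sum.inl` (`= shiftC`). [folklore] -/
theorem wireC_shiftWire_inl {n : ℕ} (L : ℕ) (u : Fin n ⊕ ℕ) :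
    wireC (shiftWire Sum.inl L u) = shiftC L (wireC u) := by
  rcases u with i | j <;> simp [shiftWire, shiftC, wireC]

/-- `gateC` commutes with `reloc`. [folklore] -/
theorem gateC_reloc (m : ℕ) {n n' : ℕ} (ρ : Fin n' → Fin n ⊕ ℕ) (L : ℕ) (g : Gate (Fin n')) :
    gateC m (reloc ρ L g) = relocC (List.ofFn fun i => wireC (ρ i)) L (gateC m g) := by
  simp only [gateC, reloc_fn, relocC, Prod.mk.injEq, true_and, List.map_ofFn]
  exact congrArg List.ofFn (funext fun a => wireC_shiftWire ρ L (g.args a))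

/-- `gateC` commutes with `par`. [folklore] -/
theorem gateC_par (m : ℕ) {n : ℕ} (L : ℕ) (g : Gate (Fin n)) :
    gateC m (par L g) = shiftGateC L (gateC m g) := by
  simp only [gateC, par, reloc_fn, shiftGateC, Prod.mk.injEq, true_and, List.map_ofFn]
  exact congrArg List.ofFn (funext fun a => wireC_shiftWire_inl L (g.args a))

/-- `plug` on codes: the gates of `A` relocated behind `gs` with input table `T`, and the
relocated output. [folklore] -/
def plugC (gs : List GateC) (T : List WireC) (ags : List GateC) (aout : WireC) : List GateC × WireC :=
  (gs ++ ags.map (relocC T gs.length), substW T gs.length aout)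

/-- **`gateC` commutes with `plug`.** [folklore] -/
theorem map_gateC_plug (m : ℕ) {n n' : ℕ} (gs : List (Gate (Fin n))) (ρ : Fin n' → Fin n ⊕ ℕ)
    (A : Circuit (Fin n')) :
    (plug gs ρ A).1.map (gateC m) =
      (plugC (gs.map (gateC m)) (List.ofFn fun i => wireC (ρ i)) (A.gates.map (gateC m)) (wireC A.output)).1 ∧
    wireC (plug gs ρ A).2 =
      (plugC (gs.map (gateC m)) (List.ofFn fun i => wireC (ρ i)) (A.gates.map (gateC m)) (wireC A.output)).2 := by
  refine ⟨?_, ?_⟩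
  · simp only [plug, plugC, List.map_append, List.map_map, List.length_map]
    congr 1
    exact List.map_congr_left fun g _ => gateC_reloc m ρ _ g
  · simp only [plug, plugC, List.length_map]
    exact wireC_shiftWire ρ _ _

/-- `parBlocks` on codes. [folklore] -/
def parBlocksC : List (List GateC × WireC) → List GateC × List WireC
  | [] => ([], [])
  | (gs, o) :: rest =>
    (gs ++ (parBlocksC rest).1.map (shiftGateC gs.length), o :: (parBlocksC rest).2.map (shiftC gs.length))

/-- **`gateC` commutes with `parBlocks`.** [folklore] -/
theorem map_gateC_parBlocks (m : ℕ) {n : ℕ} :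
    ∀ bs : List (List (Gate (Fin n)) × (Fin n ⊕ ℕ)),
      (parBlocks bs).1.map (gateC m) = (parBlocksC (bs.map fun b => (b.1.map (gateC m), wireC b.2))).1 ∧
      (parBlocks bs).2.map wireC = (parBlocksC (bs.map fun b => (b.1.map (gateC m), wireC b.2))).2
  | [] => ⟨rfl, rfl⟩
  | (gs, o) :: rest => by
    obtain ⟨ih1, ih2⟩ := map_gateC_parBlocks m rest
    refine ⟨?_, ?_⟩
    · simp only [parBlocks, parBlocksC, List.map_cons, List.map_append, List.map_map, List.length_map, ← ih1]
      congr 1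
      exact List.map_congr_left fun g _ => gateC_par m _ g
    · simp only [parBlocks, parBlocksC, List.map_cons, List.map_map, List.length_map, ← ih2]
      congr 1
      exact List.map_congr_left fun u _ => wireC_shiftWire_inl _ u

/-! ### The gate appenders on codes -/

/-- `andWire` on codes. [folklore] -/
def andC (gs : List GateC) (u v : WireC) : List GateC × WireC := (gs ++ [(1, [u, v])], (1, gs.length))

/-- `orWire` on codes. [folklore] -/
def orC (gs : List GateC) (u v : WireC) : List GateC × WireC := (gs ++ [(2, [u, v])], (1, gs.length))

/-- `notWire` on codes. [folklore] -/
def notC (gs : List GateC) (u : WireC) : List GateC × WireC := (gs ++ [(0, [u])], (1, gs.length))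

/-- `or₃Wire` on codes. [folklore] -/
def or₃C (gs : List GateC) (u v t : WireC) : List GateC × WireC := (gs ++ [(2, [u, v, t])], (1, gs.length))

/-- `addSlot` on codes. [folklore] -/
def addSlotC (gs : List GateC) (a s p : WireC) : List GateC × WireC :=
  let r1 := andC gs a s
  let r2 := notC r1.1 a
  let r3 := notC r2.1 s
  let r4 := andC r3.1 r2.2 r3.2
  let r5 := orC r4.1 r1.2 r4.2
  andC r5.1 p r5.2

/-- The code of a binary `∧`/`∨` gate. [folklore] -/
theorem gateC_bigGate_two (m : ℕ) {n : ℕ} (b : Bool) (u v : Fin n ⊕ ℕ) :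
    gateC m (bigGate b 2 ![u, v]) = (if b then 1 else 2, [wireC u, wireC v]) := by
  cases b
  · have hfn : (bigGate false 2 ![u, v]).fn = GateFn.or 2 := bigGate_fn false 2 _
    rw [gateC, hfn, accCode_or]
    simp [orCode, bigGate]
  · have hfn : (bigGate true 2 ![u, v]).fn = GateFn.and 2 := bigGate_fn true 2 _
    rw [gateC, hfn, accCode_and]
    simp [bigGate]

/-- The code of a ternary `∨` gate. [folklore] -/
theorem gateC_bigGate_three (m : ℕ) {n : ℕ} (u v t : Fin n ⊕ ℕ) :
    gateC m (bigGate false 3 ![u, v, t]) = (2, [wireC u, wireC v, wireC t]) := by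
  have hfn : (bigGate false 3 ![u, v, t]).fn = GateFn.or 3 := bigGate_fn false 3 _
  rw [gateC, hfn, accCode_or]
  simp [orCode, bigGate, List.ofFn_succ]

/-- The code of a negation gate. [folklore] -/
theorem gateC_notGate (m : ℕ) {n : ℕ} (u : Fin n ⊕ ℕ) : gateC m (notGate u) = (0, [wireC u]) := by
  have hfn : (notGate u).fn = GateFn.not := rfl
  rw [gateC, hfn, BT.accCode_not]
  simp [notGate]

/-- `gateC` commutes with `andWire`/`orWire`. [folklore] -/
theorem map_gateC_andWire (m : ℕ) {n : ℕ} (gs : List (Gate (Fin n))) (u v : Fin n ⊕ ℕ) :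
    (andWire gs u v).1.map (gateC m) = (andC (gs.map (gateC m)) (wireC u) (wireC v)).1 ∧
    wireC (andWire gs u v).2 = (andC (gs.map (gateC m)) (wireC u) (wireC v)).2 := by
  simp [andWire, andC, gateC_bigGate_two, wireC]

/-- `gateC` commutes with `orWire`. [folklore] -/
theorem map_gateC_orWire (m : ℕ) {n : ℕ} (gs : List (Gate (Fin n))) (u v : Fin n ⊕ ℕ) :
    (orWire gs u v).1.map (gateC m) = (orC (gs.map (gateC m)) (wireC u) (wireC v)).1 ∧
    wireC (orWire gs u v).2 = (orC (gs.map (gateC m)) (wireC u) (wireC v)).2 := by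
  simp [orWire, orC, gateC_bigGate_two, wireC]

/-- `gateC` commutes with `notWire`. [folklore] -/
theorem map_gateC_notWire (m : ℕ) {n : ℕ} (gs : List (Gate (Fin n))) (u : Fin n ⊕ ℕ) :
    (notWire gs u).1.map (gateC m) = (notC (gs.map (gateC m)) (wireC u)).1 ∧
    wireC (notWire gs u).2 = (notC (gs.map (gateC m)) (wireC u)).2 := by
  simp [notWire, notC, gateC_notGate, wireC]

/-- `gateC` commutes with `or₃Wire`. [folklore] -/
theorem map_gateC_or₃Wire (m : ℕ) {n : ℕ} (gs : List (Gate (Fin n))) (u v t : Fin n ⊕ ℕ) :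
    (or₃Wire gs u v t).1.map (gateC m) = (or₃C (gs.map (gateC m)) (wireC u) (wireC v) (wireC t)).1 ∧
    wireC (or₃Wire gs u v t).2 = (or₃C (gs.map (gateC m)) (wireC u) (wireC v) (wireC t)).2 := by
  simp [or₃Wire, or₃C, gateC_bigGate_three, wireC]

/-- `gateC` commutes with `addSlot`. [folklore] -/
theorem map_gateC_addSlot (m : ℕ) {n : ℕ} (gs : List (Gate (Fin n))) (a s' p : Fin n ⊕ ℕ) :
    (addSlot gs a s' p).1.map (gateC m) = (addSlotC (gs.map (gateC m)) (wireC a) (wireC s') (wireC p)).1 ∧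
    wireC (addSlot gs a s' p).2 = (addSlotC (gs.map (gateC m)) (wireC a) (wireC s') (wireC p)).2 := by
  simp [addSlot, addSlotC, andWire, orWire, notWire, andC, orC, notC, gateC_bigGate_two, gateC_notGate,
    wireC, List.map_append]

/-! ### Fan-in normalisation on codes -/

/-- `reduceMod` commutes with an injective map. [folklore] -/
theorem reduceMod_map {α β : Type*} [DecidableEq α] [DecidableEq β] {f : α → β}
    (hf : Function.Injective f) (m : ℕ) (l : List α) :
    reduceMod m (l.map f) = (reduceMod m l).map f := by
  simp only [reduceMod, List.dedup_map_of_injective hf, List.flatMap_map, List.map_flatMap,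
    List.map_replicate]
  refine List.flatMap_congr fun a _ => ?_
  rw [List.count_map_of_injective _ _ hf]

/-- **Fan-in normalisation on codes**, with the re-coding of the normalised gate. [folklore] -/
def normC (m : ℕ) (g : GateC) : GateC :=
  if g.1 = 1 then (1, g.2.dedup)
  else if g.1 = 2 then (orCode g.2.dedup.length, g.2.dedup)
  else if g.1 = 3 then (modCode m (reduceMod m g.2).length, reduceMod m g.2)
  else g

/-- The code of a gate built by `Gate.ofList`. [folklore] -/
theorem gateC_ofList (m : ℕ) {n : ℕ} (Gf : ∀ k : ℕ, (Fin k → Bool) → Bool) (ws : List (Fin n ⊕ ℕ)) :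
    gateC m (Gate.ofList Gf ws) = (accCode m ⟨ws.length, Gf ws.length⟩, ws.map wireC) := by
  simp only [gateC, Gate.ofList, Gate.fn, Prod.mk.injEq, true_and]
  congr 1
  exact List.ofFn_getElem

/-- **`gateC` commutes with fan-in normalisation**: `gateC m (g.normFanIn m) = normC m (gateC m g)`.
[folklore] -/
theorem gateC_normFanIn (m : ℕ) {n : ℕ} (g : Gate (Fin n)) :
    gateC m (g.normFanIn m) = normC m (gateC m g) := by
  have hcode : (gateC m g).1 = accCode m g.fn := rfl
  have hws : (gateC m g).2 = (List.ofFn g.args).map wireC := rfl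
  unfold Gate.normFanIn normC
  rw [hcode, hws]
  rcases Gate.accCode_cases m g.fn with h | h | h | ⟨h1, h2, h3⟩
  · rw [if_pos h, if_pos h, gateC_ofList, List.dedup_map_of_injective wireC_injective]
    exact Prod.ext (accCode_and m _) rfl
  · rw [if_neg (by omega), if_pos h, if_neg (by omega), if_pos h, gateC_ofList,
      List.dedup_map_of_injective wireC_injective, List.length_map]
    exact Prod.ext (accCode_or m _) rfl
  · rw [if_neg (by omega), if_neg (by omega), if_pos h, if_neg (by omega), if_neg (by omega), if_pos h,
      gateC_ofList, reduceMod_map wireC_injective, List.length_map]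
    exact Prod.ext (accCode_modGate m _) rfl
  · rw [if_neg h1, if_neg h2, if_neg h3, if_neg h1, if_neg h2, if_neg h3]

/-! ### The code of the SAT instance -/

section Stages

variable (n : ℕ) (fam : List (WireC × List GateC)) (wout : WireC) (wgs : List GateC)

/-- Stage 0 on codes: the clause circuits side by side (gates and output table). [folklore] -/
def sGC : List GateC × List WireC := parBlocksC (fam.map fun b => (b.2, b.1))

/-- The table of the output wires of the clause circuits, indexed by `coordPos`. [folklore] -/
def TC : List WireC := (sGC fam).2

/-- The input table of the `ℓ`-th copy of `W`: the index-bit wires of slot `ℓ`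
(positions `ℓ (n + 2) + i + 2`). [folklore] -/
def rhoC (T : List WireC) (n ℓ : ℕ) : List WireC :=
  List.ofFn fun i : Fin n => T.getD (ℓ * (n + 2) + ((i : ℕ) + 2)) (0, 0)

/-- Stage 1 on codes. [folklore] -/
def s1C : List GateC × WireC := plugC (sGC fam).1 (rhoC (TC fam) n 0) wgs wout
/-- Stage 2 on codes. [folklore] -/
def s2C : List GateC × WireC := plugC (s1C n fam wout wgs).1 (rhoC (TC fam) n 1) wgs wout
/-- Stage 3 on codes. [folklore] -/
def s3C : List GateC × WireC := plugC (s2C n fam wout wgs).1 (rhoC (TC fam) n 2) wgs wout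
/-- Stage 4 on codes. [folklore] -/
def s4C : List GateC × WireC :=
  addSlotC (s3C n fam wout wgs).1 (s1C n fam wout wgs).2 ((TC fam).getD 1 (0, 0)) ((TC fam).getD 0 (0, 0))
/-- Stage 5 on codes. [folklore] -/
def s5C : List GateC × WireC :=
  addSlotC (s4C n fam wout wgs).1 (s2C n fam wout wgs).2 ((TC fam).getD (n + 2 + 1) (0, 0))
    ((TC fam).getD (n + 2) (0, 0))
/-- Stage 6 on codes. [folklore] -/
def s6C : List GateC × WireC :=
  addSlotC (s5C n fam wout wgs).1 (s3C n fam wout wgs).2 ((TC fam).getD (2 * (n + 2) + 1) (0, 0))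
    ((TC fam).getD (2 * (n + 2)) (0, 0))
/-- Stage 7 on codes. [folklore] -/
def s7C : List GateC × WireC :=
  or₃C (s6C n fam wout wgs).1 (s4C n fam wout wgs).2 (s5C n fam wout wgs).2 (s6C n fam wout wgs).2
/-- Stage 8 on codes. [folklore] -/
def s8C : List GateC × WireC := notC (s7C n fam wout wgs).1 (s7C n fam wout wgs).2

/-- **The code of the SAT instance `D`** as a function of the codes of the clause circuits
(`fam`: output wire and gates of `G κ`, `κ` in print order) and of `W` (`wout`, `wgs`): the
stages on codes, fan-in normalisation with re-coding, serialisation.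
[cite: Williams2014, proof of Thm. 3.2 (p. 13)] -/
def satInstanceC (m : ℕ) : List ℕ :=
  serialize n (s8C n fam wout wgs).2 ((s8C n fam wout wgs).1.map (normC m))

end Stages

/-- The codes of the clause circuits in print order. [folklore] -/
def famC (m : ℕ) {w : ℕ} (G : ClauseCoord w → Circuit (Fin w)) : List (WireC × List GateC) :=
  (clauseCoordList w).map fun κ => (wireC (G κ).output, (G κ).gates.map (gateC m))

section Eq

open WitnessCheck

variable {w : ℕ} (m : ℕ) (G : ClauseCoord w → Circuit (Fin w)) (W : Circuit (Fin w))

/-- Stage 0 commutes with coding. [folklore] -/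
theorem stG_code : (stG G).1.map (gateC m) = (sGC (famC m G)).1 ∧ (stG G).2.map wireC = TC (famC m G) := by
  have h := map_gateC_parBlocks m ((List.ofFn fun k : Fin (3 * (w + 2)) => G (coordOf k)).map
    fun C => (C.gates, C.output))
  have hl : ((List.ofFn fun k : Fin (3 * (w + 2)) => G (coordOf k)).map fun C => (C.gates, C.output)).map
      (fun b => (b.1.map (gateC m), wireC b.2)) = (famC m G).map fun b => (b.2, b.1) := by
    rw [famC, clauseCoordList_eq_ofFn, List.map_ofFn, List.map_ofFn, List.map_ofFn, List.map_ofFn]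
    rfl
  rw [hl] at h
  exact h

/-- The output wires of stage 0, coded. [folklore] -/
theorem wireC_outG (κ : ClauseCoord w) : wireC (outG G κ) = (TC (famC m G)).getD (coordPos κ) (0, 0) := by
  rw [← (stG_code m G).2, outG, List.getD_eq_getElem?_getD, List.getElem?_map,
    List.getElem?_eq_getElem]
  rfl

/-- The input tables of the copies of `W`, coded. [folklore] -/
theorem ofFn_wireC_ρW (ℓ : Fin 3) :
    (List.ofFn fun i => wireC (ρW G ℓ i)) = rhoC (TC (famC m G)) w ℓ := by
  unfold rhoC ρW
  congr 1
  funext i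
  rw [wireC_outG m G]
  simp [coordPos, fieldPos]

/-- Stage 1 commutes with coding. [folklore] -/
theorem st1_code : (st1 G W).1.map (gateC m) = (s1C w (famC m G) (wireC W.output) (W.gates.map (gateC m))).1 ∧
    wireC (st1 G W).2 = (s1C w (famC m G) (wireC W.output) (W.gates.map (gateC m))).2 := by
  have h := map_gateC_plug m (stG G).1 (ρW G 0) W
  rw [(stG_code m G).1, ofFn_wireC_ρW m G 0] at h
  exact h

/-- Stage 2 commutes with coding. [folklore] -/
theorem st2_code : (st2 G W).1.map (gateC m) = (s2C w (famC m G) (wireC W.output) (W.gates.map (gateC m))).1 ∧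
    wireC (st2 G W).2 = (s2C w (famC m G) (wireC W.output) (W.gates.map (gateC m))).2 := by
  have h := map_gateC_plug m (st1 G W).1 (ρW G 1) W
  rw [(st1_code m G W).1, ofFn_wireC_ρW m G 1] at h
  exact h

/-- Stage 3 commutes with coding. [folklore] -/
theorem st3_code : (st3 G W).1.map (gateC m) = (s3C w (famC m G) (wireC W.output) (W.gates.map (gateC m))).1 ∧
    wireC (st3 G W).2 = (s3C w (famC m G) (wireC W.output) (W.gates.map (gateC m))).2 := by
  have h := map_gateC_plug m (st2 G W).1 (ρW G 2) W
  rw [(st2_code m G W).1, ofFn_wireC_ρW m G 2] at h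
  exact h

/-- Stage 4 commutes with coding. [folklore] -/
theorem st4_code : (st4 G W).1.map (gateC m) = (s4C w (famC m G) (wireC W.output) (W.gates.map (gateC m))).1 ∧
    wireC (st4 G W).2 = (s4C w (famC m G) (wireC W.output) (W.gates.map (gateC m))).2 := by
  have h := map_gateC_addSlot m (st3 G W).1 (aW G W 0) (outG G (0, Sum.inl true)) (outG G (0, Sum.inl false))
  have haW : wireC (aW G W 0) = (s1C w (famC m G) (wireC W.output) (W.gates.map (gateC m))).2 :=
    (st1_code m G W).2
  rw [(st3_code m G W).1, wireC_outG m G, wireC_outG m G, haW] at h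
  simp only [coordPos, fieldPos, Fin.val_zero, zero_mul, zero_add] at h
  exact h

/-- Stage 5 commutes with coding. [folklore] -/
theorem st5_code : (st5 G W).1.map (gateC m) = (s5C w (famC m G) (wireC W.output) (W.gates.map (gateC m))).1 ∧
    wireC (st5 G W).2 = (s5C w (famC m G) (wireC W.output) (W.gates.map (gateC m))).2 := by
  have h := map_gateC_addSlot m (st4 G W).1 (aW G W 1) (outG G (1, Sum.inl true)) (outG G (1, Sum.inl false))
  have haW : wireC (aW G W 1) = (s2C w (famC m G) (wireC W.output) (W.gates.map (gateC m))).2 :=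
    (st2_code m G W).2
  rw [(st4_code m G W).1, wireC_outG m G, wireC_outG m G, haW] at h
  simp only [coordPos, fieldPos, Fin.val_one, one_mul, add_zero] at h
  exact h

/-- Stage 6 commutes with coding. [folklore] -/
theorem st6_code : (st6 G W).1.map (gateC m) = (s6C w (famC m G) (wireC W.output) (W.gates.map (gateC m))).1 ∧
    wireC (st6 G W).2 = (s6C w (famC m G) (wireC W.output) (W.gates.map (gateC m))).2 := by
  have h := map_gateC_addSlot m (st5 G W).1 (aW G W 2) (outG G (2, Sum.inl true)) (outG G (2, Sum.inl false))
  have haW : wireC (aW G W 2) = (s3C w (famC m G) (wireC W.output) (W.gates.map (gateC m))).2 :=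
    (st3_code m G W).2
  rw [(st5_code m G W).1, wireC_outG m G, wireC_outG m G, haW] at h
  simp only [coordPos, fieldPos, Fin.val_two, add_zero] at h
  exact h

/-- Stage 7 commutes with coding. [folklore] -/
theorem st7_code : (st7 G W).1.map (gateC m) = (s7C w (famC m G) (wireC W.output) (W.gates.map (gateC m))).1 ∧
    wireC (st7 G W).2 = (s7C w (famC m G) (wireC W.output) (W.gates.map (gateC m))).2 := by
  have h := map_gateC_or₃Wire m (st6 G W).1 (st4 G W).2 (st5 G W).2 (st6 G W).2
  rw [(st6_code m G W).1, (st4_code m G W).2, (st5_code m G W).2, (st6_code m G W).2] at h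
  exact h

/-- Stage 8 commutes with coding. [folklore] -/
theorem st8_code : (st8 G W).1.map (gateC m) = (s8C w (famC m G) (wireC W.output) (W.gates.map (gateC m))).1 ∧
    wireC (st8 G W).2 = (s8C w (famC m G) (wireC W.output) (W.gates.map (gateC m))).2 := by
  have h := map_gateC_notWire m (st7 G W).1 (st7 G W).2
  rw [(st7_code m G W).1, (st7_code m G W).2] at h
  exact h

/-- The gates of the instance (definitional; unfolded one step at a time, since a direct `rfl`
sends the unifier down the whole program). [folklore] -/
theorem gates_satInstance : (satInstance G W m).gates = (st8 G W).1.map (Gate.normFanIn m) := by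
  have e1 : satInstance G W m = (circuit G W).normFanIn m := rfl
  have e2 : ∀ C : Circuit (Fin w), (C.normFanIn m).gates = C.gates.map (Gate.normFanIn m) := fun C => rfl
  have e3 : (circuit G W).gates = (st8 G W).1 := rfl
  rw [e1, e2, e3]

/-- The output of the instance (definitional). [folklore] -/
theorem output_satInstance : (satInstance G W m).output = (st8 G W).2 := by
  have e1 : satInstance G W m = (circuit G W).normFanIn m := rfl
  have e2 : ∀ C : Circuit (Fin w), (C.normFanIn m).output = C.output := fun C => rfl
  have e3 : (circuit G W).output = (st8 G W).2 := rfl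
  rw [e1, e2, e3]

/-- `gateC` after `normFanIn` on a whole program. [folklore] -/
theorem map_gateC_map_normFanIn {n : ℕ} (gs : List (Gate (Fin n))) :
    (gs.map (Gate.normFanIn m)).map (gateC m) = (gs.map (gateC m)).map (normC m) := by
  induction gs with
  | nil => rfl
  | cons g gs ih => simp only [List.map_cons, ih, gateC_normFanIn]

/-- **The code of `D` computed from the codes**: on the codes of the clause circuits `G κ` in
print order and of `W`, `satInstanceC` is `circuitCodeList m (satInstance G W m)` — for ALL
families `G` and circuits `W` (no basis hypothesis: gates outside `accBasis m` print as `4` and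
are left alone by both sides). [cite: Williams2014, proof of Thm. 3.2 (p. 13)] -/
theorem satInstanceC_eq :
    satInstanceC w (famC m G) (wireC W.output) (W.gates.map (gateC m)) m =
      circuitCodeList m (satInstance G W m) := by
  have hg : (satInstance G W m).gates = (st8 G W).1.map (Gate.normFanIn m) := gates_satInstance m G W
  have ho : (satInstance G W m).output = (st8 G W).2 := output_satInstance m G W
  rw [circuitCodeList_eq_serialize, hg, ho, (st8_code m G W).2, map_gateC_map_normFanIn,
    (st8_code m G W).1]
  rfl

/-- **The code of the witness-check circuit `circuit G W`** (the instance WITHOUT fan-in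
normalisation, used by the machine `B` of `Williams2014MachineB.lean`): the stages on codes,
serialised as they are. [cite: Williams2014, proof of Thm. 3.2 (p. 13)] -/
def circuitC (n : ℕ) (fam : List (WireC × List GateC)) (wout : WireC) (wgs : List GateC) : List ℕ :=
  serialize n (s8C n fam wout wgs).2 (s8C n fam wout wgs).1

/-- The gates of the witness-check circuit (definitional). [folklore] -/
theorem gates_circuit : (circuit G W).gates = (st8 G W).1 := rfl

/-- The output of the witness-check circuit (definitional). [folklore] -/
theorem output_circuit : (circuit G W).output = (st8 G W).2 := rfl

/-- **The code of `circuit G W` computed from the codes**: on the codes of the clause circuits in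
print order and of `W`, `circuitC` is `circuitCodeList m (circuit G W)`, for all `G` and `W`.
[cite: Williams2014, proof of Thm. 3.2 (p. 13)] -/
theorem circuitC_eq :
    circuitC w (famC m G) (wireC W.output) (W.gates.map (gateC m)) = circuitCodeList m (circuit G W) := by
  rw [circuitCodeList_eq_serialize, circuitC, gates_circuit, output_circuit, (st8_code m G W).2,
    (st8_code m G W).1]

end Eq

/-! ### Decoding the guessed witness: validity, realisation, canonical codes -/

/-- The canonical symbolic code of a decoded gate of code `c` and arity `k`: the code its gate
FUNCTION prints with (`accCode_and`, `accCode_or`, `accCode_modGate`). [folklore] -/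
def canon (m c k : ℕ) : ℕ :=
  if c = 0 then 0 else if c = 1 then 1 else if c = 2 then orCode k else modCode m k

/-- Canonicalising a gate code. [folklore] -/
def canonC (m : ℕ) (g : GateC) : GateC := (canon m g.1 g.2.length, g.2)

/-- A wire code is in range at gate position `j` of a program on `n` inputs: an input `< n` or
an earlier gate `< j`. [folklore] -/
def wireOK (n j : ℕ) (p : WireC) : Bool :=
  (p.1 == 0 && decide (p.2 < n)) || (p.1 == 1 && decide (p.2 < j))

/-- A gate code is admissible at position `j`: code `≤ 3`, negations unary, wires in range.
[folklore] -/
def gateOK (n j : ℕ) (g : GateC) : Bool :=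
  decide (g.1 ≤ 3) && (!(g.1 == 0) || g.2.length == 1) && g.2.all (wireOK n j)

/-- All gates admissible at their positions (from position `j` on). [folklore] -/
def gatesOK (n : ℕ) : ℕ → List GateC → Bool
  | _, [] => true
  | j, g :: gs => gateOK n j g && gatesOK n (j + 1) gs

/-- The depth of a wire code given the depths of the gates. [folklore] -/
def wdC (ds : List ℕ) (p : WireC) : ℕ := if p.1 = 0 then 0 else ds.getD p.2 0

/-- The `ac`-depth of a gate code given the depths of the earlier gates (negations weigh `0`).
[folklore] -/
def gateDepthC (ds : List ℕ) (g : GateC) : ℕ :=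
  (if g.1 = 0 then 0 else 1) + (g.2.map (wdC ds)).foldr max 0

/-- The `ac`-depths of all gates of a program code (`GateList.wdepths acWeight` on codes).
[folklore] -/
def depthsC (gs : List GateC) : List ℕ := gs.foldl (fun ds g => ds ++ [gateDepthC ds g]) []

/-- **Validity of a would-be circuit code** on `n` inputs with depth bound `dW` and size bound
`sz`: admissible gates, output wire in range, at most `sz` gates, `ac`-depth of the output at
most `dW`. [folklore] -/
def validC (n dW sz : ℕ) (out : WireC) (gs : List GateC) : Bool :=
  gatesOK n 0 gs && wireOK n gs.length out && decide (gs.length ≤ sz) &&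
    decide (wdC (depthsC gs) out ≤ dW)

/-- The wire of a wire code (junk `gate 0` for an input out of range). [folklore] -/
def wireOfC (n : ℕ) (p : WireC) : Fin n ⊕ ℕ :=
  if p.1 = 0 then (if h : p.2 < n then Sum.inl ⟨p.2, h⟩ else Sum.inr 0) else Sum.inr p.2

/-- The truth table of a decoded gate of code `c` and arity `k`. [folklore] -/
def opOf (m c k : ℕ) (v : Fin k → Bool) : Bool :=
  if c = 0 then (if h : 0 < k then !(v ⟨0, h⟩) else true)
  else if c = 1 then decide (∀ i, v i = true)
  else if c = 2 then decide (∃ i, v i = true)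
  else decide (GateFn.numOnes v % m ≠ 0)

/-- The gate of a gate code. [folklore] -/
def gateOf (m n : ℕ) (g : GateC) : Gate (Fin n) :=
  ⟨g.2.length, opOf m g.1 g.2.length, fun a => wireOfC n (g.2[(a : ℕ)])⟩

/-! #### Elementary facts -/

/-- `gatesOK` unfolded: every gate is admissible at its position. [folklore] -/
theorem gatesOK_iff (n : ℕ) : ∀ (j : ℕ) (gs : List GateC),
    gatesOK n j gs = true ↔ ∀ (i : ℕ) (h : i < gs.length), gateOK n (j + i) gs[i] = true
  | j, [] => by simp [gatesOK]
  | j, g :: gs => by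
    rw [gatesOK, Bool.and_eq_true, gatesOK_iff n (j + 1) gs]
    constructor
    · rintro ⟨hg, hgs⟩ i hi
      rcases i with _ | i
      · rw [List.getElem_cons_zero, Nat.add_zero]; exact hg
      · have := hgs i (by simpa using hi)
        rw [List.getElem_cons_succ, show j + (i + 1) = j + 1 + i by omega]
        exact this
    · intro h
      refine ⟨?_, fun i hi => ?_⟩
      · have := h 0 (by simp)
        rw [List.getElem_cons_zero, Nat.add_zero] at this
        exact this
      · have := h (i + 1) (by simpa using hi)
        rw [List.getElem_cons_succ, show j + (i + 1) = j + 1 + i by omega] at this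
        exact this

/-- `gateOK` unfolded. [folklore] -/
theorem gateOK_iff {n j : ℕ} {g : GateC} : gateOK n j g = true ↔
    g.1 ≤ 3 ∧ (g.1 = 0 → g.2.length = 1) ∧ ∀ p ∈ g.2, wireOK n j p = true := by
  simp only [gateOK, Bool.and_eq_true, decide_eq_true_eq, Bool.or_eq_true, Bool.not_eq_true',
    beq_eq_false_iff_ne, ne_eq, beq_iff_eq, List.all_eq_true]
  constructor
  · rintro ⟨⟨h1, h2⟩, h3⟩
    exact ⟨h1, fun h0 => h2.resolve_left (fun h => h h0), h3⟩
  · rintro ⟨h1, h2, h3⟩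
    exact ⟨⟨h1, by by_cases h0 : g.1 = 0 <;> simp [h0, h2]⟩, h3⟩

/-- `wireOK` unfolded. [folklore] -/
theorem wireOK_iff {n j : ℕ} {p : WireC} : wireOK n j p = true ↔
    (p.1 = 0 ∧ p.2 < n) ∨ (p.1 = 1 ∧ p.2 < j) := by
  simp [wireOK]

/-- Later positions admit the same wires. [folklore] -/
theorem wireOK_mono {n j j' : ℕ} {p : WireC} (h : wireOK n j p = true) (hj : j ≤ j') : wireOK n j' p = true := by
  rw [wireOK_iff] at h ⊢
  rcases h with h | ⟨h1, h2⟩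
  · exact Or.inl h
  · exact Or.inr ⟨h1, lt_of_lt_of_le h2 hj⟩

/-- A wire code in range decodes to a wire that prints back to it. [folklore] -/
theorem wireC_wireOfC {n j : ℕ} {p : WireC} (h : wireOK n j p = true) : wireC (wireOfC n p) = p := by
  obtain ⟨t, i⟩ := p
  simp only [wireOK_iff] at h
  rcases h with ⟨rfl, h2⟩ | ⟨rfl, h2⟩
  · simp [wireOfC, h2, wireC]
  · simp [wireOfC, wireC]

/-- A wire code in range at position `j` decodes to an input or a gate `< j`. [folklore] -/
theorem wireOfC_eq_inr {n j : ℕ} {p : WireC} (h : wireOK n j p = true) {m' : ℕ}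
    (hm : wireOfC n p = Sum.inr m') : m' < j := by
  obtain ⟨t, i⟩ := p
  simp only [wireOK_iff] at h
  rcases h with ⟨rfl, h2⟩ | ⟨rfl, h2⟩
  · simp [wireOfC, h2] at hm
  · simp only [wireOfC, one_ne_zero, if_false, Sum.inr.injEq] at hm
    omega

/-! #### The gate functions of decoded gates -/

/-- The gate function of a decoded gate. [folklore] -/
theorem fn_gateOf (m n : ℕ) (g : GateC) : (gateOf m n g).fn = ⟨g.2.length, opOf m g.1 g.2.length⟩ := rfl

/-- Code `0`, arity `1`: negation. [folklore] -/
theorem opOf_zero_one (m : ℕ) : opOf m 0 1 = fun v => !(v 0) := by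
  funext v; simp [opOf]

/-- Code `1`: conjunction. [folklore] -/
theorem opOf_one (m k : ℕ) : opOf m 1 k = (GateFn.and k).2 := by
  funext v; simp [opOf, GateFn.and]

/-- Code `2`: disjunction. [folklore] -/
theorem opOf_two (m k : ℕ) : opOf m 2 k = (GateFn.or k).2 := by
  funext v; simp [opOf, GateFn.or]

/-- Code `3`: `MODₘ`. [folklore] -/
theorem opOf_three (m k : ℕ) : opOf m 3 k = (GateFn.modGate m k).2 := by
  funext v; simp [opOf, GateFn.modGate]

/-- The gate function of an admissible decoded gate, by code. [folklore] -/
theorem fn_gateOf_cases (m n : ℕ) {j : ℕ} {g : GateC} (h : gateOK n j g = true) :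
    (g.1 = 0 ∧ (gateOf m n g).fn = GateFn.not) ∨ (g.1 = 1 ∧ (gateOf m n g).fn = GateFn.and g.2.length) ∨
    (g.1 = 2 ∧ (gateOf m n g).fn = GateFn.or g.2.length) ∨ (g.1 = 3 ∧ (gateOf m n g).fn = GateFn.modGate m g.2.length) := by
  obtain ⟨hle, h0, -⟩ := gateOK_iff.1 h
  rw [fn_gateOf]
  have hc : g.1 = 0 ∨ g.1 = 1 ∨ g.1 = 2 ∨ g.1 = 3 := by omega
  rcases hc with hc | hc | hc | hc
  · refine Or.inl ⟨hc, ?_⟩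
    have hk := h0 hc
    rw [hc, hk, opOf_zero_one]; rfl
  · exact Or.inr (Or.inl ⟨hc, by rw [hc, opOf_one]; rfl⟩)
  · exact Or.inr (Or.inr (Or.inl ⟨hc, by rw [hc, opOf_two]; rfl⟩))
  · exact Or.inr (Or.inr (Or.inr ⟨hc, by rw [hc, opOf_three]; rfl⟩))

/-- Admissible decoded gates are in `accBasis m`. [folklore] -/
theorem fn_gateOf_mem (m n : ℕ) {j : ℕ} {g : GateC} (h : gateOK n j g = true) :
    (gateOf m n g).fn ∈ accBasis m := by
  rcases fn_gateOf_cases m n h with ⟨-, e⟩ | ⟨-, e⟩ | ⟨-, e⟩ | ⟨-, e⟩ <;> rw [e]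
  · exact acBasis_subset_accBasis m mem_acBasis_not
  · exact acBasis_subset_accBasis m (and_mem_acBasis _)
  · exact acBasis_subset_accBasis m (or_mem_acBasis _)
  · exact Set.mem_union_right _ (Set.mem_iUnion.2 ⟨_, rfl⟩)

/-- The printed code of an admissible decoded gate is its canonical code. [folklore] -/
theorem accCode_fn_gateOf (m n : ℕ) {j : ℕ} {g : GateC} (h : gateOK n j g = true) :
    accCode m (gateOf m n g).fn = canon m g.1 g.2.length := by
  rcases fn_gateOf_cases m n h with ⟨hc, e⟩ | ⟨hc, e⟩ | ⟨hc, e⟩ | ⟨hc, e⟩ <;> rw [e, hc]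
  · simp [canon]
  · simp [canon, accCode_and]
  · simp [canon, accCode_or]
  · simp [canon, accCode_modGate]

/-- The `ac`-weight of an admissible decoded gate: `0` for negations. [folklore] -/
theorem acWeight_fn_gateOf (m n : ℕ) {j : ℕ} {g : GateC} (h : gateOK n j g = true) :
    acWeight (gateOf m n g).fn = if g.1 = 0 then 0 else 1 := by
  rcases fn_gateOf_cases m n h with ⟨hc, e⟩ | ⟨hc, e⟩ | ⟨hc, e⟩ | ⟨hc, e⟩ <;> rw [e, hc]
  · simp
  · simp
  · simp
  · unfold acWeight
    rw [if_neg (modGate_ne_not m _), if_neg (by decide)]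

/-- **An admissible decoded gate prints as its canonicalised code.** [folklore] -/
theorem gateC_gateOf (m n : ℕ) {j : ℕ} {g : GateC} (h : gateOK n j g = true) :
    gateC m (gateOf m n g) = canonC m g := by
  refine Prod.ext (accCode_fn_gateOf m n h) ?_
  obtain ⟨-, -, hw⟩ := gateOK_iff.1 h
  show (List.ofFn fun a : Fin g.2.length => wireOfC n (g.2[(a : ℕ)])).map wireC = g.2
  rw [List.map_ofFn]
  conv_rhs => rw [← List.ofFn_getElem (xs := g.2)]
  congr 1
  funext a
  exact wireC_wireOfC (hw _ (List.getElem_mem _))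

/-! #### The realised circuit -/

/-- Well-formedness of the decoded program. [folklore] -/
theorem wf_gateOf {n m : ℕ} {gs : List GateC} (hgs : gatesOK n 0 gs = true) :
    ∀ (j : ℕ) (hj : j < (gs.map (gateOf m n)).length) (a : Fin ((gs.map (gateOf m n))[j]).arity) (m' : ℕ),
      ((gs.map (gateOf m n))[j]).args a = Sum.inr m' → m' < j := by
  intro j hj a m' ha
  have hj' : j < gs.length := by simpa using hj
  have hg : gateOK n j gs[j] = true := by simpa using (gatesOK_iff n 0 gs).1 hgs j hj'
  obtain ⟨-, -, hw⟩ := gateOK_iff.1 hg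
  have key : ∀ (g' : Gate (Fin n)), g' = gateOf m n gs[j] → ∀ (a : Fin g'.arity) (m' : ℕ),
      g'.args a = Sum.inr m' → m' < j := by
    rintro g' rfl a m' ha
    exact wireOfC_eq_inr (hw _ (List.getElem_mem _)) ha
  exact key _ (List.getElem_map _) a m' ha

/-- **The circuit of a valid code** (a constant circuit if the code is invalid). [folklore] -/
def realize (m n dW sz : ℕ) (out : WireC) (gs : List GateC) : Circuit (Fin n) :=
  if h : validC n dW sz out gs = true then
    { gates := gs.map (gateOf m n)
      output := wireOfC n out
      wf := wf_gateOf (by simp only [validC, Bool.and_eq_true] at h; exact h.1.1.1)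
      wf_output := fun m' hm => by
        simp only [validC, Bool.and_eq_true] at h
        rw [List.length_map]
        exact wireOfC_eq_inr h.1.1.2 hm }
  else Circuit.const (Fin n) false

section Realize

variable {m n dW sz : ℕ} {out : WireC} {gs : List GateC} (hv : validC n dW sz out gs = true)
include hv

/-- The gates of the realised circuit. [folklore] -/
theorem realize_gates : (realize m n dW sz out gs).gates = gs.map (gateOf m n) := by
  rw [realize, dif_pos hv]

/-- The output of the realised circuit. [folklore] -/
theorem realize_output : (realize m n dW sz out gs).output = wireOfC n out := by
  rw [realize, dif_pos hv]

omit hv in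
/-- The four parts of validity. [folklore] -/
theorem validC_parts (hv : validC n dW sz out gs = true) :
    gatesOK n 0 gs = true ∧ wireOK n gs.length out = true ∧ gs.length ≤ sz ∧ wdC (depthsC gs) out ≤ dW := by
  simpa [validC, Bool.and_eq_true, and_assoc] using hv

/-- The size of the realised circuit. [folklore] -/
theorem size_realize : (realize m n dW sz out gs).size = gs.length := by
  rw [Circuit.size, realize_gates hv, List.length_map]

/-- The realised circuit is over `accBasis m`. [folklore] -/
theorem realize_isOver : (realize m n dW sz out gs).IsOver (accBasis m) := by
  intro g hg
  rw [realize_gates hv] at hg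
  obtain ⟨gc, hgc, rfl⟩ := List.mem_map.1 hg
  obtain ⟨j, hj, rfl⟩ := List.getElem_of_mem hgc
  exact fn_gateOf_mem m n (by simpa using (gatesOK_iff n 0 gs).1 (validC_parts hv).1 j hj)

/-- **The gates of the realised circuit print as the canonicalised codes.** [folklore] -/
theorem map_gateC_realize : (realize m n dW sz out gs).gates.map (gateC m) = gs.map (canonC m) := by
  rw [realize_gates hv, List.map_map]
  apply List.ext_getElem
  · simp
  · intro i h1 h2
    simp only [List.getElem_map, Function.comp_apply]
    exact gateC_gateOf m n (j := i) (by
      simpa using (gatesOK_iff n 0 gs).1 (validC_parts hv).1 i (by simpa using h2))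

/-- The output of the realised circuit prints as the given output code. [folklore] -/
theorem wireC_realize_output : wireC (realize m n dW sz out gs).output = out := by
  rw [realize_output hv]
  exact wireC_wireOfC (validC_parts hv).2.1

end Realize

/-! #### The depth of the realised circuit -/

/-- Members are below the `max`-fold. [folklore] -/
private theorem le_foldr_max {l : List ℕ} {a : ℕ} (h : a ∈ l) : a ≤ l.foldr max 0 := by
  induction l with
  | nil => cases h
  | cons b l ih =>
    rw [List.foldr_cons]
    rcases List.mem_cons.1 h with rfl | h
    · exact le_max_left _ _
    · exact (ih h).trans (le_max_right _ _)

/-- A `sup` over the positions of a list is the `max`-fold of the mapped list. [folklore] -/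
theorem sup_univ_getElem {α : Type*} (l : List α) (f : α → ℕ) :
    (Finset.univ.sup fun a : Fin l.length => f (l[(a : ℕ)])) = (l.map f).foldr max 0 := by
  apply le_antisymm
  · refine Finset.sup_le fun a _ => le_foldr_max ?_
    exact List.mem_map.2 ⟨_, List.getElem_mem a.2, rfl⟩
  · refine foldr_max_zero_le fun x hx => ?_
    obtain ⟨y, hy, rfl⟩ := List.mem_map.1 hx
    obtain ⟨i, hi, rfl⟩ := List.getElem_of_mem hy
    exact Finset.le_sup (f := fun a : Fin l.length => f (l[(a : ℕ)])) (Finset.mem_univ ⟨i, hi⟩)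

/-- `depthsC` of one more gate. [folklore] -/
theorem depthsC_append_singleton (gs : List GateC) (g : GateC) :
    depthsC (gs ++ [g]) = depthsC gs ++ [gateDepthC (depthsC gs) g] := by
  simp [depthsC, List.foldl_append]

/-- The depth of a decoded wire in range. [folklore] -/
theorem wireDepthOf_wireOfC {n j : ℕ} (ds : List ℕ) {p : WireC} (h : wireOK n j p = true) :
    wireDepthOf ds (wireOfC n p) = wdC ds p := by
  obtain ⟨t, i⟩ := p
  simp only [wireOK_iff] at h
  rcases h with ⟨rfl, h2⟩ | ⟨rfl, h2⟩
  · simp [wireOfC, h2, wdC]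
  · simp [wireOfC, wdC]

/-- **The `ac`-depths of the decoded program are `depthsC`.** [folklore] -/
theorem wdepths_map_gateOf {n : ℕ} (m : ℕ) :
    ∀ gs : List GateC, gatesOK n 0 gs = true → wdepths acWeight (gs.map (gateOf m n)) = depthsC gs := by
  intro gs
  induction gs using List.reverseRecOn with
  | nil => intro; rfl
  | append_singleton gs g ih =>
    intro hok
    have hall := (gatesOK_iff n 0 _).1 hok
    have hgs : gatesOK n 0 gs = true := by
      refine (gatesOK_iff n 0 gs).2 fun i hi => ?_
      have := hall i (by simp; omega)
      simpa [List.getElem_append_left hi] using this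
    have hg : gateOK n gs.length g = true := by
      have := hall gs.length (by simp)
      simpa using this
    obtain ⟨-, -, hw⟩ := gateOK_iff.1 hg
    rw [List.map_append, List.map_singleton, wdepths_append_singleton, ih hgs, depthsC_append_singleton,
      acWeight_fn_gateOf m n hg]
    congr 2
    unfold gateDepthC
    congr 1
    rw [← sup_univ_getElem]
    refine Finset.sup_congr rfl fun a _ => ?_
    exact wireDepthOf_wireOfC _ (hw _ (List.getElem_mem _))

/-- **The `ac`-depth of the realised circuit** is the computed depth of its output code, hence
`≤ dW`. [folklore] -/
theorem acDepth_realize_le {m n dW sz : ℕ} {out : WireC} {gs : List GateC} (hv : validC n dW sz out gs = true) :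
    (realize m n dW sz out gs).acDepth ≤ dW := by
  obtain ⟨hgs, hout, -, hd⟩ := validC_parts hv
  change Circuit.depthWith _ acWeight ≤ dW
  rw [circuit_depthWith, realize_gates hv, realize_output hv, wdepths_map_gateOf m gs hgs,
    wireDepthOf_wireOfC _ hout]
  exact hd

/-! #### Canonical codes are fixed by canonicalisation; printed codes are valid -/

/-- The printed code of a gate over `accBasis m` is canonical. [folklore] -/
theorem canonC_gateC (m : ℕ) {n : ℕ} {g : Gate (Fin n)} (hg : g.fn ∈ accBasis m) :
    canonC m (gateC m g) = gateC m g := by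
  simp only [canonC, gateC, List.length_map, List.length_ofFn, Prod.mk.injEq, and_true]
  have hfn := GateFn.ofAccCode_accCode hg
  have hk : g.fn.1 = g.arity := rfl
  rcases Gate.accCode_cases m g.fn with h | h | h | ⟨h1, h2, h3⟩
  · rw [h]; simp [canon]
  · -- a disjunction prints `2`, so its arity is not `1`
    rw [h]
    have e : g.fn = GateFn.or g.arity := BT.fn_eq_or_of_accCode h
    have : accCode m (GateFn.or g.arity) = 2 := by rw [← e]; exact h
    rw [accCode_or] at this
    simp [canon, this]
  · rw [h]
    have e : g.fn = GateFn.modGate m g.arity := BT.fn_eq_mod_of_accCode h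
    have : accCode m (GateFn.modGate m g.arity) = 3 := by rw [← e]; exact h
    rw [accCode_modGate] at this
    simp [canon, this]
  · have h0 : accCode m g.fn = 0 := by have := BT.accCode_le_three hg; omega
    rw [h0]; simp [canon]

/-! ### Printed codes are valid -/

/-- A `sup` over `Fin k` is the `max`-fold of the mapped `List.ofFn`. [folklore] -/
theorem sup_univ_ofFn {α : Type*} {k : ℕ} (f : Fin k → α) (h : α → ℕ) :
    (Finset.univ.sup fun a : Fin k => h (f a)) = ((List.ofFn f).map h).foldr max 0 := by
  apply le_antisymm
  · refine Finset.sup_le fun a _ => le_foldr_max ?_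
    exact List.mem_map.2 ⟨f a, List.mem_ofFn.2 ⟨a, rfl⟩, rfl⟩
  · refine foldr_max_zero_le fun x hx => ?_
    obtain ⟨y, hy, rfl⟩ := List.mem_map.1 hx
    obtain ⟨a, rfl⟩ := List.mem_ofFn.1 hy
    exact Finset.le_sup (f := fun a : Fin k => h (f a)) (Finset.mem_univ a)

/-- The weight field of a printed gate code is the `ac`-weight. [folklore] -/
theorem ite_accCode_eq_acWeight (m : ℕ) (f : GateFn) : (if accCode m f = 0 then 0 else 1) = acWeight f := by
  by_cases h : accCode m f = 0
  · rw [if_pos h, BT.fn_eq_not_of_accCode h, acWeight_not]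
  · rw [if_neg h, BT.acWeight_eq_one_of_accCode_ne h]

/-- The depth of a printed wire code is the depth of the wire. [folklore] -/
theorem wdC_wireC {n : ℕ} (ds : List ℕ) (u : Fin n ⊕ ℕ) : wdC ds (wireC u) = wireDepthOf ds u := by
  cases u <;> simp [wdC, wireC]

/-- **`depthsC` of printed codes is `wdepths acWeight`** (all programs). [folklore] -/
theorem depthsC_map_gateC (m : ℕ) {n : ℕ} (gs : List (Gate (Fin n))) :
    depthsC (gs.map (gateC m)) = wdepths acWeight gs := by
  induction gs using List.reverseRecOn with
  | nil => rfl
  | append_singleton gs g ih =>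
    rw [List.map_append, List.map_singleton, depthsC_append_singleton, wdepths_append_singleton, ih]
    congr 2
    unfold gateDepthC
    rw [show (gateC m g).1 = accCode m g.fn from rfl, ite_accCode_eq_acWeight]
    congr 1
    rw [show (gateC m g).2 = (List.ofFn g.args).map wireC from rfl, List.map_map,
      ← sup_univ_ofFn g.args (wdC (wdepths acWeight gs) ∘ wireC)]
    simp only [Function.comp_apply, wdC_wireC]

/-- Printed wires are in range. [folklore] -/
theorem wireOK_wireC {n j : ℕ} {u : Fin n ⊕ ℕ} (hu : ∀ m', u = Sum.inr m' → m' < j) :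
    wireOK n j (wireC u) = true := by
  rw [wireOK_iff]
  rcases u with i | m'
  · exact Or.inl ⟨rfl, i.2⟩
  · exact Or.inr ⟨rfl, hu m' rfl⟩

/-- Printed gates of a circuit over `accBasis m` are admissible at their positions. [folklore] -/
theorem gatesOK_map_gateC (m : ℕ) {n : ℕ} (C : Circuit (Fin n)) (hC : C.IsOver (accBasis m)) :
    gatesOK n 0 (C.gates.map (gateC m)) = true := by
  refine (gatesOK_iff n 0 _).2 fun j hj => ?_
  rw [List.length_map] at hj
  rw [gateOK_iff]
  simp only [List.getElem_map, Nat.zero_add]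
  have hB : (C.gates[j]).fn ∈ accBasis m := hC _ (List.getElem_mem hj)
  refine ⟨BT.accCode_le_three hB, fun h0 => ?_, fun p hp => ?_⟩
  · -- a negation is unary
    have := congrArg Sigma.fst (BT.fn_eq_not_of_accCode h0)
    show ((List.ofFn (C.gates[j]).args).map wireC).length = 1
    rw [List.length_map, List.length_ofFn]
    exact this
  · obtain ⟨u, hu, rfl⟩ := List.mem_map.1 hp
    obtain ⟨a, -, rfl⟩ := List.mem_ofFn.1 hu
    exact wireOK_wireC fun m' hm => C.wf j hj a m' hm

/-- **The printed code of a circuit over `accBasis m` of depth `≤ dW` and size `≤ sz` is valid.**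
[folklore] -/
theorem validC_of_circuit (m : ℕ) {n dW sz : ℕ} (C : Circuit (Fin n)) (hC : C.IsOver (accBasis m))
    (hd : C.acDepth ≤ dW) (hs : C.size ≤ sz) :
    validC n dW sz (wireC C.output) (C.gates.map (gateC m)) = true := by
  have hdep : wdC (depthsC (C.gates.map (gateC m))) (wireC C.output) = C.acDepth := by
    rw [depthsC_map_gateC, wdC_wireC]
    exact (circuit_depthWith C acWeight).symm
  simp only [validC, Bool.and_eq_true, decide_eq_true_eq, List.length_map]
  exact ⟨⟨⟨gatesOK_map_gateC m C hC, wireOK_wireC C.wf_output⟩, hs⟩, by rw [hdep]; exact hd⟩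

/-- Canonicalisation fixes the printed gates of a circuit over `accBasis m`. [folklore] -/
theorem map_canonC_map_gateC (m : ℕ) {n : ℕ} (C : Circuit (Fin n)) (hC : C.IsOver (accBasis m)) :
    (C.gates.map (gateC m)).map (canonC m) = C.gates.map (gateC m) := by
  rw [List.map_map]
  exact List.map_congr_left fun g hg => canonC_gateC m (hC g hg)

/-! ### Parsing flattened gate codes: a fold with a four-register state -/

/-- The state of the flat-code parser: the current partial gate (raw naturals), the number of
naturals still wanted for it, whether its arity field is awaited, and the completed raw gates.
[folklore] -/
structure PS where
  /-- The current partial gate, as the naturals read so far. -/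
  cur : List ℕ
  /-- The number of wire naturals still wanted for the current gate. -/
  need : ℕ
  /-- Whether the next natural is the arity field of the current gate. -/
  wait : Bool
  /-- The completed gates, raw. -/
  done : List (List ℕ)

/-- One step of the parser on the next natural `x`. [folklore] -/
def pstep (s : PS) (x : ℕ) : PS :=
  if s.cur = [] then ⟨[x], 0, true, s.done⟩
  else if s.wait then
    (if x = 0 then ⟨[], 0, false, s.done ++ [s.cur ++ [x]]⟩ else ⟨s.cur ++ [x], 2 * x, false, s.done⟩)
  else
    (if s.need ≤ 1 then ⟨[], 0, false, s.done ++ [s.cur ++ [x]]⟩ else ⟨s.cur ++ [x], s.need - 1, false, s.done⟩)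

/-- The parser: fold `pstep` from the empty state. [folklore] -/
def parseFlat (l : List ℕ) : PS := l.foldl pstep ⟨[], 0, false, []⟩

/-- Pairing up a list of naturals into wire codes (a trailing odd element is dropped). [folklore] -/
def pairUp : List ℕ → List WireC
  | t :: i :: rest => (t, i) :: pairUp rest
  | _ => []

/-- A raw gate `c, k, wires…` as a gate code. [folklore] -/
def rawToGate : List ℕ → GateC
  | c :: _ :: rest => (c, pairUp rest)
  | [c] => (c, [])
  | [] => (0, [])

/-- **Deserialising a would-be circuit code**: header `n, t, i, sz`, then the gates parsed by
`parseFlat`, accepted if no partial gate is left and exactly `sz` gates were read. [folklore] -/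
def deserialize : List ℕ → Option (ℕ × WireC × List GateC)
  | n :: t :: i :: sz :: rest =>
    if (parseFlat rest).cur = [] ∧ (parseFlat rest).done.length = sz then
      some (n, (t, i), (parseFlat rest).done.map rawToGate)
    else none
  | _ => none

/-- `pairUp` inverts the flattening of wires. [folklore] -/
theorem pairUp_flatMap (ws : List WireC) : pairUp (ws.flatMap fun p => [p.1, p.2]) = ws := by
  induction ws with
  | nil => rfl
  | cons p ws ih => simp [pairUp, ih]

/-- `rawToGate` inverts `flatGate`. [folklore] -/
theorem rawToGate_flatGate (g : GateC) : rawToGate (flatGate g) = g := by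
  obtain ⟨c, ws⟩ := g
  simp [flatGate, rawToGate, pairUp_flatMap]

/-- Reading the wire naturals of a gate whose arity field has been read. [folklore] -/
theorem foldl_pstep_wires (D : List (List ℕ)) :
    ∀ (xs : List ℕ) (cur : List ℕ) (rest : List ℕ), cur ≠ [] → xs ≠ [] →
      (xs ++ rest).foldl pstep ⟨cur, xs.length, false, D⟩ =
        rest.foldl pstep ⟨[], 0, false, D ++ [cur ++ xs]⟩
  | [], _, _, _, h => absurd rfl h
  | [x], cur, rest, hc, _ => by
    simp [pstep, hc]
  | x :: y :: xs, cur, rest, hc, _ => by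
    rw [List.cons_append, List.foldl_cons]
    have hstep : pstep ⟨cur, (x :: y :: xs).length, false, D⟩ x = ⟨cur ++ [x], (y :: xs).length, false, D⟩ := by
      simp [pstep, hc]
    rw [hstep, foldl_pstep_wires D (y :: xs) (cur ++ [x]) rest (by simp) (by simp), List.append_assoc]
    rfl

/-- Reading one whole flattened gate. [folklore] -/
theorem foldl_pstep_flatGate (D : List (List ℕ)) (g : GateC) (rest : List ℕ) :
    (flatGate g ++ rest).foldl pstep ⟨[], 0, false, D⟩ = rest.foldl pstep ⟨[], 0, false, D ++ [flatGate g]⟩ := by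
  obtain ⟨c, ws⟩ := g
  simp only [flatGate, List.cons_append, List.foldl_cons]
  have h1 : pstep ⟨[], 0, false, D⟩ c = ⟨[c], 0, true, D⟩ := by simp [pstep]
  rw [h1]
  rcases ws with _ | ⟨p, ws⟩
  · have h2 : pstep ⟨[c], 0, true, D⟩ 0 = ⟨[], 0, false, D ++ [[c, 0]]⟩ := by simp [pstep]
    simp [h2]
  · have h2 : pstep ⟨[c], 0, true, D⟩ ((p :: ws).length) =
        ⟨[c, (p :: ws).length], 2 * (p :: ws).length, false, D⟩ := by
      simp [pstep]
    rw [h2]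
    have hlen : ((p :: ws).flatMap fun q => [q.1, q.2]).length = 2 * (p :: ws).length := by
      simp [List.length_flatMap]; ring
    rw [← hlen, foldl_pstep_wires D _ [c, (p :: ws).length] rest (by simp) (by simp)]
    simp

/-- **The parser on flattened gates**: all gates are read, no partial gate is left. [folklore] -/
theorem parseFlat_flatMap (gs : List GateC) :
    parseFlat (gs.flatMap flatGate) = ⟨[], 0, false, gs.map flatGate⟩ := by
  suffices h : ∀ (D : List (List ℕ)) (rest : List ℕ),
      (gs.flatMap flatGate ++ rest).foldl pstep ⟨[], 0, false, D⟩ =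
        rest.foldl pstep ⟨[], 0, false, D ++ gs.map flatGate⟩ by
    have := h [] []
    simpa [parseFlat] using this
  induction gs with
  | nil => intro D rest; simp
  | cons g gs ih =>
    intro D rest
    rw [List.flatMap_cons, List.append_assoc, foldl_pstep_flatGate, ih]
    simp

/-- **Deserialising a serialised code gives it back.** [folklore] -/
theorem deserialize_serialize (n : ℕ) (out : WireC) (gs : List GateC) :
    deserialize (serialize n out gs) = some (n, out, gs) := by
  obtain ⟨t, i⟩ := out
  have hmap : gs.map (rawToGate ∘ flatGate) = gs := by
    conv_rhs => rw [← List.map_id gs]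
    exact List.map_congr_left fun g _ => rawToGate_flatGate g
  simp only [serialize, deserialize, parseFlat_flatMap, List.length_map, and_self, if_true, List.map_map, hmap]

/-- The parser never holds more naturals than it has read. [folklore] -/
theorem length_parse_le (l : List ℕ) :
    (parseFlat l).cur.length + ((parseFlat l).done.map List.length).sum ≤ l.length := by
  suffices h : ∀ (s : PS) (l : List ℕ),
      (l.foldl pstep s).cur.length + ((l.foldl pstep s).done.map List.length).sum ≤
        s.cur.length + (s.done.map List.length).sum + l.length by
    simpa [parseFlat] using h ⟨[], 0, false, []⟩ l
  intro s l
  induction l generalizing s with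
  | nil => simp
  | cons x l ih =>
    rw [List.foldl_cons]
    refine (ih (pstep s x)).trans ?_
    have : (pstep s x).cur.length + ((pstep s x).done.map List.length).sum ≤
        s.cur.length + (s.done.map List.length).sum + 1 := by
      unfold pstep
      split_ifs <;> simp <;> omega
    simp only [List.length_cons]
    omega

/-- `pairUp` halves. [folklore] -/
theorem length_pairUp_le : ∀ l : List ℕ, 2 * (pairUp l).length ≤ l.length
  | [] => by simp [pairUp]
  | [_] => by simp [pairUp]
  | _ :: _ :: rest => by
    have := length_pairUp_le rest
    simp [pairUp]; omega

/-- The arity of a raw gate is at most half its length. [folklore] -/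
theorem length_rawToGate_le (r : List ℕ) : 2 * (rawToGate r).2.length ≤ r.length := by
  rcases r with _ | ⟨c, _ | ⟨k, rest⟩⟩
  · simp [rawToGate]
  · simp [rawToGate]
  · have := length_pairUp_le rest
    simp [rawToGate]; omega

/-- **Deserialised gates have arity at most half the length of the code.** [folklore] -/
theorem arity_le_of_deserialize {l : List ℕ} {n : ℕ} {out : WireC} {gs : List GateC}
    (h : deserialize l = some (n, out, gs)) : ∀ g ∈ gs, 2 * g.2.length ≤ l.length := by
  intro g hg
  match l, h with
  | n' :: t :: i :: sz :: rest, h =>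
    simp only [deserialize] at h
    split_ifs at h with hc
    simp only [Option.some.injEq, Prod.mk.injEq] at h
    obtain ⟨-, -, rfl⟩ := h
    obtain ⟨r, hr, rfl⟩ := List.mem_map.1 hg
    have h1 := length_rawToGate_le r
    have h2 := length_parse_le rest
    have h3 : r.length ≤ ((parseFlat rest).done.map List.length).sum :=
      List.single_le_sum (fun _ _ => Nat.zero_le _) _ (List.mem_map.2 ⟨r, hr, rfl⟩)
    simp only [List.length_cons]
    omega

/-! ### The realised witness feeds the code of the witness-check circuit -/

/-- **Soundness glue for stage `F`**: for a valid parsed witness code `(out, gs)` on `w` inputs,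
the code-level circuit computed from the codes of the `G κ` and the CANONICALISED parsed gates is
the code of `circuit G W` for the realised `W = realize m w dW sz out gs` (which is over
`accBasis m`, of depth `≤ dW` and size `= |gs| ≤ sz`). [folklore] -/
theorem circuitC_realize (m : ℕ) {w dW sz : ℕ} (G : ClauseCoord w → Circuit (Fin w)) {out : WireC}
    {gs : List GateC} (hv : validC w dW sz out gs = true) :
    circuitC w (famC m G) out (gs.map (canonC m)) =
      circuitCodeList m (WitnessCheck.circuit G (realize m w dW sz out gs)) := by
  rw [← circuitC_eq m G (realize m w dW sz out gs), wireC_realize_output hv, map_gateC_realize hv]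

/-- **Completeness glue for stage `F`**: the printed code of a circuit `W` over `accBasis m`
deserialises to `(w, wireC W.output, printed gates)`, these are valid for every depth/size bound
that `W` meets, canonicalisation fixes them, and the code-level circuit on them is the code of
`circuit G W`. [folklore] -/
theorem circuitC_of_circuit (m : ℕ) {w dW sz : ℕ} (G : ClauseCoord w → Circuit (Fin w)) (W : Circuit (Fin w))
    (hW : W.IsOver (accBasis m)) (hd : W.acDepth ≤ dW) (hs : W.size ≤ sz) :
    deserialize (circuitCodeList m W) = some (w, wireC W.output, W.gates.map (gateC m)) ∧
    validC w dW sz (wireC W.output) (W.gates.map (gateC m)) = true ∧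
    (W.gates.map (gateC m)).map (canonC m) = W.gates.map (gateC m) ∧
    circuitC w (famC m G) (wireC W.output) (W.gates.map (gateC m)) = circuitCodeList m (WitnessCheck.circuit G W) := by
  refine ⟨?_, validC_of_circuit m W hW hd hs, map_canonC_map_gateC m W hW, circuitC_eq m G W⟩
  rw [circuitCodeList_eq_serialize]
  exact deserialize_serialize _ _ _

end SatCode

end Literature.Computability.Complexity
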